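import Mathlib
import HarnessLib
import Summits.QuantumFields.YangMills.Theorems.MirrorModularBoostsHypercubicLimitPlaneLimitsDefs
import Summits.QuantumFields.YangMills.Theorems.LangevinControlUVOSLegsFromFemtoAndGapStubAssemblyPermutations
import Summits.QuantumFields.YangMills.Theorems.PencilRigidityWeakCouplingHypercubicLimitCoordPerm

/-!
# Line `Sketch` (coupling response): the `S₄` half of the signed-permutation invariance of the summed
plane-string limits (stub `coordPermOfPlaneLimits`)

Sub-goal `coordPermOfPlaneLimits` of crux `stmt-QuantumFields-16154` (`HypercubicLimit`), line `Sketch`, step Z3b-SP.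
Coordinate permutations `P_π : (P_π v)ᵢ = v_{π⁻¹ i}` of `ℝ⁴` are EXACT lattice symmetries of the renormalised
plane-string distributions: for every step `k`, `planeDist r sch k n q (P_π F) = planeDist r sch k n (permPlane π⁻¹ ∘ q) F`
(the torus Wilson state is `configPerm π`-invariant — tree block `rpBlock_momentPerm` —, a permuted plaquette is the
re-sorted plaquette at the permuted corner, the box `(box L)ⁿ`, the counterterm `m_k/6` and the scalar `(c_k a_k⁴)ⁿ`
do not depend on the string), and `q ↦ permPlane π⁻¹ ∘ q` is a bijection of `Planeⁿ`; so the summed lattice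
distributions agree term by term along `φ`, and the limits on `⁰𝒮` (which is `linActMulti`-stable) coincide.  This
chain is the twin crux's landed `planeSum_linActMulti_coordPerm`
(`PencilRigidityWeakCouplingHypercubicLimitCoordPerm`, stated with the abbreviation
`coordPerm π := LinearIsometryEquiv.piLpCongrLeft 2 ℝ ℝ π`); the registered statement below is its unfolded form.

Refs: OsterwalderSchrader1973 §2 (Euclidean covariance on `⁰𝒮`); Wilson1974 (hypercubic symmetry of the lattice
action); GlimmJaffe1987 §6.1.
-/

noncomputable section

open scoped SchwartzMap
open MeasureTheory Filter Topology
open Literature.MathematicalPhysics.AQFT Literature.MathematicalPhysics.QuantumLattice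
open Literature.MathematicalPhysics.QuantumFieldTheory
open Summit.QuantumFields.YangMills.Theorems.OSLegsFromFemtoAndGap (coordPerm)

namespace Summit.QuantumFields.YangMills.Cruxes.HypercubicLimit.CouplingResponse

/-- **Registered sub-goal `coordPermOfPlaneLimits` (line `Sketch`, step Z3b-SP, the `S₄` half of the signed
permutations)**: along a `PlaneLimits r sch φ T` package the candidate one-field family `planeSum T = Σ_q T n q` is
invariant on `⁰𝒮` under the coordinate permutation `v ↦ (v_{π⁻¹ i})ᵢ` of `ℝ⁴` acting diagonally on `n`-point test
functions.  Coordinate permutations are exact lattice symmetries (`sum_planeDist_linActMulti_coordPerm`: the summed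
renormalised plane-string distributions of `P_π F` and of `F` agree at every step), `P_π F ∈ ⁰𝒮`
(`IsOffDiagonal.linActMulti`), and limits along `φ` are unique; packaged by the twin crux as
`planeSum_linActMulti_coordPerm`, of which this is the form with `coordPerm π` unfolded to
`LinearIsometryEquiv.piLpCongrLeft 2 ℝ ℝ π`. [folklore] -/
theorem coordPermOfPlaneLimits : ∀ (G : Type) [Group G] [TopologicalSpace G] [IsTopologicalGroup G] [CompactSpace G] [MeasurableSpace G] [BorelSpace G] (r : LatticeRep G) (sch : SpeciesScheme (YMSpecies G)) (φ : ℕ → ℕ) (T : (n : ℕ) → (Fin n → Plane) → (𝓢((Fin n → EuclideanSpace ℝ (Fin 4)), ℂ) →L[ℂ] ℂ)), PlaneLimits r sch φ T → ∀ (π : Equiv.Perm (Fin 4)) (n : ℕ) (F : 𝓢((Fin n → EuclideanSpace ℝ (Fin 4)), ℂ)), IsOffDiagonal F → planeSum T n (linActMulti (LinearIsometryEquiv.piLpCongrLeft 2 ℝ ℝ π) F) = planeSum T n F :=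
  fun G _ _ _ _ _ _ r sch φ T h π n F hF =>
    Summit.QuantumFields.YangMills.Theorems.WeakCouplingHypercubicLimit.TraceNormColdPressure.planeSum_linActMulti_coordPerm
      G r sch φ T h π n F hF

end Summit.QuantumFields.YangMills.Cruxes.HypercubicLimit.CouplingResponse

end
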